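import Summits.Ventures.HodgeRepro2.T5SU11CoefficientPow

/-!
# Rühl's normalisation characterises the Haar measure `μ_R`

`T5SU11CoefficientPow` shows `∫_G cosh(η/2)^{-3p} dμ_R = 2/(3p - 2)` for the explicit Haar measure
`μ_R = ν/π` and every `p > 2/3` — the printed values of S4 l. 82.  By the uniqueness of Haar
measures, the printed value at a SINGLE `p` already pins the measure down: a Haar measure `μ` of
`SU(1,1)` with `∫_G cosh(η/2)^{-3p} dμ = 2/(3p - 2)` for one `p > 2/3` IS `μ_R`.  So the
identification of `μ_R` with Rühl's printed measure `½ sinh η dη (4π)⁻² dψ₁ dψ₂` reduces to two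
printed facts — that Rühl's measure is a Haar measure and that his integral equals `2/(3p - 2)` —
and needs no comparison of densities or angular normalisations.

Blind lane: Mathlib + the HodgeRepro2 prefix only; no sorry; axioms ⊆ {propext, Classical.choice,
Quot.sound}.
-/

namespace Summit.Ventures.HodgeRepro2.T5RuhlMeasureUnique

open MeasureTheory MeasureTheory.Measure
open T5SU11Unimodular T5SU11CoefficientL2 T5SU11CoefficientPow
open scoped Real NNReal

variable [MeasurableSpace Circle] [BorelSpace Circle]

/-- Every Haar measure of `SU(1,1)` is a positive multiple of `μ_R` (Mathlib's uniqueness). -/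
theorem eq_smul_ruhl (μ : Measure SU11) [IsHaarMeasure μ] :
    μ = haarScalarFactor μ ruhl • ruhl :=
  isMulLeftInvariant_eq_smul μ ruhl

/-- `∫_G cosh(η/2)^{-3p} dμ = c · 2/(3p - 2)` with `c = haarScalarFactor μ μ_R`. -/
theorem integral_coeffPow_eq_smul (μ : Measure SU11) [IsHaarMeasure μ] (p : ℝ) (hp : 2 / 3 < p) :
    ∫ g, coeffPow p g ∂μ = (haarScalarFactor μ ruhl : ℝ) * (2 / (3 * p - 2)) := by
  conv_lhs => rw [eq_smul_ruhl μ]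
  rw [integral_smul_nnreal_measure, NNReal.smul_def, smul_eq_mul, integral_coeffPow_ruhl p hp]

/-- **Rühl's normalisation characterises `μ_R`**: a Haar measure `μ` of `SU(1,1)` with
`∫_G cosh(η/2)^{-3p} dμ = 2/(3p - 2)` for ONE `p > 2/3` equals `μ_R`. -/
theorem eq_ruhl_of_integral (μ : Measure SU11) [IsHaarMeasure μ] (p : ℝ) (hp : 2 / 3 < p)
    (h : ∫ g, coeffPow p g ∂μ = 2 / (3 * p - 2)) : μ = ruhl := by
  have h1 := integral_coeffPow_eq_smul μ p hp
  rw [h] at h1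
  have hpos : (0 : ℝ) < 2 / (3 * p - 2) := by
    have : 0 < 3 * p - 2 := by linarith
    positivity
  have hc : (haarScalarFactor μ ruhl : ℝ) = 1 := by
    have := mul_right_cancel₀ hpos.ne' (h1.symm.trans (one_mul _).symm)
    exact this
  have hc' : haarScalarFactor μ ruhl = 1 := by exact_mod_cast hc
  rw [eq_smul_ruhl μ, hc', one_smul]

/-- The printed value at `p = 1`: `∫_G cosh(η/2)^{-3} dμ = 2` forces `μ = μ_R`. -/
theorem eq_ruhl_of_integral_one (μ : Measure SU11) [IsHaarMeasure μ]
    (h : ∫ g, coeffPow 1 g ∂μ = 2) : μ = ruhl :=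
  eq_ruhl_of_integral μ 1 (by norm_num) (by rw [h]; norm_num)

/-- The printed value at `p = 2`: `∫_G cosh(η/2)^{-6} dμ = ½` (the `L²`-value of the lowest-weight
coefficient) forces `μ = μ_R`. -/
theorem eq_ruhl_of_integral_coeffSq (μ : Measure SU11) [IsHaarMeasure μ]
    (h : ∫ g, coeffSq g ∂μ = 1 / 2) : μ = ruhl := by
  apply eq_ruhl_of_integral μ 2 (by norm_num)
  rw [coeffPow_two_eq_coeffSq, h]
  norm_num

/-- Conversely `μ_R` is the ONLY Haar measure with the printed values: `μ = μ_R ↔ ∫ cosh(η/2)^{-3} dμ = 2`. -/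
theorem eq_ruhl_iff (μ : Measure SU11) [IsHaarMeasure μ] :
    μ = ruhl ↔ ∫ g, coeffPow 1 g ∂μ = 2 :=
  ⟨fun h => by rw [h]; exact integral_coeffPow_ruhl_one, eq_ruhl_of_integral_one μ⟩

end Summit.Ventures.HodgeRepro2.T5RuhlMeasureUnique
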